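import Summits.Ventures.HSemireg.WedgeHankelDivisorTopRank
import Summits.Ventures.HSemireg.WedgeHankelDivisorKernel
import Summits.Ventures.HSemireg.WedgeHankelTwoNodesShear

/-!
# Venture HSemireg — THE DIVISOR KERNEL LAW ON `P¹`: the class `Σ_i exp(λ_i Θ)·p_i(Θ) + (order-(P∞+1) node at ∞)` has kernel
# `(⋂_i (SI_k ⊔ Φs λ_i (xRich(k, P_i)))) ⊓ (SI_k ⊔ yRich(k, P∞))` — total order `≤ min(k + 1, n + 1 − k)`; E8/E9/E10/F1/F2b as faces

HONEST FRAMING. Part of the Lean index of the computation cell `pub-hsemireg` (seat p10 gen 16, Sunday typer «UNIFORM-IN-n»).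
Finite-dimensional EXTERIOR ALGEBRA over a field ONLY: no variety, no cohomology theory, no sheaf, no Ext group, no semiregularity map;
nothing here says that HC / HC_CM / HC_AV holds; no Literature fact is declared or used.  Custodian versions as in `WedgeHankelSiegelIdeal` (1/3) and
`WedgeHankelFrameChange`; the dictionary (top window `rev_n q∞` ↦ node at `∞`; divisor `Σ_i (P_i+1)[λ_i] + (P∞+1)[∞]`) is QUOTED, never asserted.

WHAT IS IN THE TREE / KEYED.  E5 `Kr_w_expMul_of_order` (node `λ`), E7 `Kr_w_rev_of_order` (node `∞`: `SI_k ⊔ yRich(k, P∞)`), F2b `Kr_w_expMul_sum` (finite divisors, by D2's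
codimension subadditivity), F3a `rank_hankel1_expMul_sum_add_rev` (the `P¹` rank law).  THIS FILE runs F2b's count once more with the node at `∞` added (index `Option (Fin r)`):
* §62 `iInf_Kr_le_Kr_w_sum_add_rev` (a form killing every finite node's class and the top window kills the class); `finrank_Kr_w_rev_of_order_add` (the node at `∞` has
  codimension `(P∞+1)·C(n,k)`); **`finrank_Kr_w_expMul_sum_add_rev_add`: `dim Kr + D·C(n,k) = C(2n,k)`**, `D = Σ_i (P_i+1) + (P∞+1)`.
* §63 **THE `P¹` DIVISOR KERNEL LAW `Kr_w_expMul_sum_add_rev`**: distinct finite `λ_i` with exact orders `P_i`, `q∞` of exact order `P∞`, `D ≤ k + 1`, `D ≤ n + 1 − k` ⇒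
  **`Kr(univ, w_n(Σ_i expMul λ_i q_i + rev_n q∞), k) = (⋂_i (SI_k ⊔ Φs λ_i (xRich(k, P_i)))) ⊓ (SI_k ⊔ yRich(k, P∞))`**; `r = 0`: E7's node at `∞` alone; `r = 1`, `λ = 0`:
  E8's `SI_k ⊔ xyRich` as an intersection (`Kr_w_node_zero_add_rev`); it depends only on the divisor.
NOT typed here: the full-row-rank regime with `∞` (generic `SI_k`); the images (`⨆`, as F2d).  Class side only.
Namespace `Summit.Ventures.HSemireg.Wedge.HankelFrameChange` (continued); new names only.
-/

open Module

namespace Summit.Ventures.HSemireg.Wedge.HankelFrameChange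

open Summit.Ventures.HSemireg.Wedge Summit.Ventures.HSemireg.Wedge.Kunneth Summit.Ventures.HSemireg.Wedge.Hankel
  Summit.Ventures.HSemireg.Wedge.HankelSiegel Summit.Ventures.HSemireg.Wedge.HankelSiegelIdeal Summit.Ventures.HSemireg.Wedge.KunnethKernel
  Summit.Ventures.HSemireg.Wedge.HankelSecant

variable (K : Type*) [Field K] {n : ℕ}

/-! ## §62. Containment and the counts -/

/-- **a form killing every finite node's class and the top-window class kills the `P¹` class.** -/
theorem iInf_Kr_le_Kr_w_sum_add_rev {r : ℕ} (q : Fin r → ℕ → K) (qinf : ℕ → K) (k : ℕ) :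
    (⨅ i, Kr K Finset.univ (w K n n (q i)) k) ⊓ Kr K Finset.univ (w K n n (rev K n qinf)) k ≤
      Kr K Finset.univ (w K n n (fun j => (∑ i, q i j) + rev K n qinf j)) k := by
  intro θ hθ
  rw [Submodule.mem_inf, Submodule.mem_iInf] at hθ
  refine mem_Kr.mpr ⟨(mem_Kr.mp hθ.2).1, ?_⟩
  rw [w_add, mul_add, (mem_Kr.mp hθ.2).2, add_zero, w_finsum, Finset.mul_sum]
  exact Finset.sum_eq_zero fun i _ => (mem_Kr.mp (hθ.1 i)).2

/-- the kernel number of the node at `∞` of exact order `P∞`: `dim Kr(univ, w_n(rev_n q∞), k) + (P∞ + 1)·C(n,k) = C(2n,k)` for `P∞ ≤ k`, `k + P∞ ≤ n` (E7's swap + E6). -/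
theorem finrank_Kr_w_rev_of_order_add {k Pinf : ℕ} (hPk : Pinf ≤ k) (hkP : k + Pinf ≤ n) {qinf : ℕ → K} (hq : ∀ j, Pinf < j → qinf j = 0)
    (hqP : qinf Pinf ≠ 0) : finrank K (Kr K Finset.univ (w K n n (rev K n qinf)) k) + (Pinf + 1) * n.choose k = (n + n).choose k := by
  have h := finrank_Kr_w_of_order K hkP hq hqP
  rw [min_eq_left hPk] at h
  rw [Kr_w_rev, (Ψs K (n := n)).toLinearEquiv.finrank_map_eq, h]

/-- **THE KERNEL NUMBER OF A `P¹` DIVISOR CLASS: `dim Kr(univ, w_n(Σ_i expMul λ_i q_i + rev_n q∞), k) + D·C(n,k) = C(2n,k)`** (F3a + THEOREM H). -/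
theorem finrank_Kr_w_expMul_sum_add_rev_add {k r : ℕ} {lam : Fin r → K} (hlam : Function.Injective lam) {P : Fin r → ℕ} {q : Fin r → ℕ → K}
    (hq : ∀ i j, P i < j → q i j = 0) (hqP : ∀ i, q i (P i) ≠ 0) {Pinf : ℕ} {qinf : ℕ → K} (hqi : ∀ j, Pinf < j → qinf j = 0) (hqiP : qinf Pinf ≠ 0)
    (hDk : ∑ i, (P i + 1) + (Pinf + 1) ≤ k + 1) (hDn : ∑ i, (P i + 1) + (Pinf + 1) ≤ n + 1 - k) :
    finrank K (Kr K Finset.univ (w K n n (fun j => (∑ i, expMul K (lam i) (q i) j) + rev K n qinf j)) k) +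
      (∑ i, (P i + 1) + (Pinf + 1)) * n.choose k = (n + n).choose k := by
  have h := finrank_Kr_w_add_rank K (n := n) k (fun j => (∑ i, expMul K (lam i) (q i) j) + rev K n qinf j)
  rw [rank_hankel1_expMul_sum_add_rev K hlam hq hqP hqi hqiP hDk hDn, Nat.mul_comm] at h
  exact h

/-- `dim Hom(univ, k) = C(2n, k)` (private copy). -/
private lemma finrank_Hom_univ_top (k : ℕ) : finrank K (Hom K (In n) Finset.univ k) = (n + n).choose k := by
  rw [Hom_univ_eq_exteriorPower, exteriorPower.finrank_eq, finrank_fintype_fun_eq_card, Fintype.card_fin]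

/-- codimension subadditivity over the `P¹` divisor (index `Option (Fin r)`, `none` = the node at `∞`):
`C(2n,k) ≤ dim ((⋂_i Kr(node i)) ⊓ Kr(node ∞)) + D·C(n,k)`. -/
theorem iInf_Kr_w_expMul_inf_rev_ge {k r : ℕ} (lam : Fin r → K) {P : Fin r → ℕ} {q : Fin r → ℕ → K}
    (hq : ∀ i j, P i < j → q i j = 0) (hqP : ∀ i, q i (P i) ≠ 0) {Pinf : ℕ} {qinf : ℕ → K} (hqi : ∀ j, Pinf < j → qinf j = 0) (hqiP : qinf Pinf ≠ 0)
    (hDk : ∑ i, (P i + 1) + (Pinf + 1) ≤ k + 1) (hDn : ∑ i, (P i + 1) + (Pinf + 1) ≤ n + 1 - k) :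
    (n + n).choose k ≤ finrank K ↥((⨅ i, Kr K Finset.univ (w K n n (expMul K (lam i) (q i))) k) ⊓ Kr K Finset.univ (w K n n (rev K n qinf)) k) +
      (∑ i, (P i + 1) + (Pinf + 1)) * n.choose k := by
  have hPi : ∀ i, P i + 1 ≤ ∑ j, (P j + 1) := fun i => Finset.single_le_sum (fun j _ => Nat.zero_le (P j + 1)) (Finset.mem_univ i)
  set F : Option (Fin r) → Submodule K (HT K (In n)) := fun o => Option.elim o (Kr K Finset.univ (w K n n (rev K n qinf)) k)
    (fun i => Kr K Finset.univ (w K n n (expMul K (lam i) (q i))) k) with hF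
  have h := finrank_le_finrank_inf_inf_add K Finset.univ (Hom K (In n) Finset.univ k) F
    (fun o _ => by cases o <;> exact Kr_le_Hom K _ _ _)
  have hinf : (Hom K (In n) Finset.univ k ⊓ Finset.univ.inf F) =
      (⨅ i, Kr K Finset.univ (w K n n (expMul K (lam i) (q i))) k) ⊓ Kr K Finset.univ (w K n n (rev K n qinf)) k := by
    rw [Finset.inf_univ_eq_iInf, iInf_option, inf_comm (F none)]
    exact inf_eq_right.mpr (inf_le_right.trans (Kr_le_Hom K _ _ _))
  rw [hinf, finrank_Hom_univ_top, Fintype.sum_option] at h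
  have hcod0 : (n + n).choose k - finrank K (F none) = (Pinf + 1) * n.choose k := by
    have := finrank_Kr_w_rev_of_order_add K (n := n) (k := k) (Pinf := Pinf) (by omega) (by omega) hqi hqiP
    show (n + n).choose k - finrank K (Kr K Finset.univ (w K n n (rev K n qinf)) k) = _
    omega
  have hcod : ∀ i : Fin r, (n + n).choose k - finrank K (F (some i)) = (P i + 1) * n.choose k := by
    intro i
    have := finrank_Kr_w_expMul_of_order_add K (n := n) (lam i) (k := k) (P := P i) (by have := hPi i; omega) (by have := hPi i; omega) (hq i) (hqP i)
    show (n + n).choose k - finrank K (Kr K Finset.univ (w K n n (expMul K (lam i) (q i))) k) = _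
    omega
  simp only [hcod0, hcod] at h
  rw [← Finset.sum_mul] at h
  have e : (Pinf + 1) * n.choose k + (∑ i, (P i + 1)) * n.choose k = (∑ i, (P i + 1) + (Pinf + 1)) * n.choose k := by ring
  rw [e] at h
  exact h

/-! ## §63. The `P¹` divisor kernel law -/

/-- **THE `P¹` DIVISOR KERNEL LAW.**  Distinct finite nodes `λ_i` (any `r ≥ 0`), coefficient sequences `q_i` supported on `[0, P_i]` with `q_i(P_i) ≠ 0`, a node at `∞` of exact
order `P∞` (`q∞` supported on `[0, P∞]`, `q∞(P∞) ≠ 0`, entering the class as the top window `rev_n q∞`), total order `D = Σ_i (P_i+1) + (P∞+1) ≤ k + 1` and `D ≤ n + 1 − k`: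
**`Kr(univ, w_n(Σ_i expMul λ_i q_i + rev_n q∞), k) = (⋂_i (SI_k ⊔ Φs λ_i (xRich(k, P_i)))) ⊓ (SI_k ⊔ yRich(k, P∞))`** — the forms killing the class are EXACTLY the forms killing
each finite node with its multiplicity AND the node at `∞` with its multiplicity. -/
theorem Kr_w_expMul_sum_add_rev {k r : ℕ} {lam : Fin r → K} (hlam : Function.Injective lam) {P : Fin r → ℕ} {q : Fin r → ℕ → K}
    (hq : ∀ i j, P i < j → q i j = 0) (hqP : ∀ i, q i (P i) ≠ 0) {Pinf : ℕ} {qinf : ℕ → K} (hqi : ∀ j, Pinf < j → qinf j = 0) (hqiP : qinf Pinf ≠ 0)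
    (hDk : ∑ i, (P i + 1) + (Pinf + 1) ≤ k + 1) (hDn : ∑ i, (P i + 1) + (Pinf + 1) ≤ n + 1 - k) :
    Kr K Finset.univ (w K n n (fun j => (∑ i, expMul K (lam i) (q i) j) + rev K n qinf j)) k =
      (⨅ i, (siegelIdeal K n k ⊔ (xRich K n k (P i)).map (Φs K (n := n) (lam i)).toLinearMap)) ⊓ (siegelIdeal K n k ⊔ yRich K n k Pinf) := by
  have hPi : ∀ i, P i + 1 ≤ ∑ j, (P j + 1) := fun i => Finset.single_le_sum (fun j _ => Nat.zero_le (P j + 1)) (Finset.mem_univ i)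
  have e1 : (⨅ i, (siegelIdeal K n k ⊔ (xRich K n k (P i)).map (Φs K (n := n) (lam i)).toLinearMap)) =
      ⨅ i, Kr K Finset.univ (w K n n (expMul K (lam i) (q i))) k :=
    iInf_congr fun i => (Kr_w_expMul_of_order K (lam i) (by have := hPi i; omega) (hq i) (hqP i)).symm
  have e2 : siegelIdeal K n k ⊔ yRich K n k Pinf = Kr K Finset.univ (w K n n (rev K n qinf)) k := (Kr_w_rev_of_order K (by omega) hqi hqiP).symm
  rw [e1, e2]
  refine (Submodule.eq_of_le_of_finrank_le (iInf_Kr_le_Kr_w_sum_add_rev K _ qinf k) ?_).symm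
  have h1 := finrank_Kr_w_expMul_sum_add_rev_add K hlam hq hqP hqi hqiP hDk hDn
  have h2 := iInf_Kr_w_expMul_inf_rev_ge K lam hq hqP hqi hqiP hDk hDn
  omega

/-- **THE KERNEL DEPENDS ONLY ON THE `P¹` DIVISOR** (not on the coefficient sequences). -/
theorem Kr_w_expMul_sum_add_rev_eq {k r : ℕ} {lam : Fin r → K} (hlam : Function.Injective lam) {P : Fin r → ℕ} {q q' : Fin r → ℕ → K}
    (hq : ∀ i j, P i < j → q i j = 0) (hqP : ∀ i, q i (P i) ≠ 0) (hq' : ∀ i j, P i < j → q' i j = 0) (hqP' : ∀ i, q' i (P i) ≠ 0)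
    {Pinf : ℕ} {qinf qinf' : ℕ → K} (hqi : ∀ j, Pinf < j → qinf j = 0) (hqiP : qinf Pinf ≠ 0) (hqi' : ∀ j, Pinf < j → qinf' j = 0) (hqiP' : qinf' Pinf ≠ 0)
    (hDk : ∑ i, (P i + 1) + (Pinf + 1) ≤ k + 1) (hDn : ∑ i, (P i + 1) + (Pinf + 1) ≤ n + 1 - k) :
    Kr K Finset.univ (w K n n (fun j => (∑ i, expMul K (lam i) (q i) j) + rev K n qinf j)) k =
      Kr K Finset.univ (w K n n (fun j => (∑ i, expMul K (lam i) (q' i) j) + rev K n qinf' j)) k := by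
  rw [Kr_w_expMul_sum_add_rev K hlam hq hqP hqi hqiP hDk hDn, Kr_w_expMul_sum_add_rev K hlam hq' hqP' hqi' hqiP' hDk hDn]

/-- **ONE NODE AT `0` PLUS THE NODE AT `∞`, AS AN INTERSECTION**: `Kr(univ, w_n(q₀ + rev_n q∞), k) = (SI_k ⊔ xRich(k, P)) ⊓ (SI_k ⊔ yRich(k, P∞))` for exact orders
`P`, `P∞` with `P + P∞ + 2 ≤ k + 1` and `≤ n + 1 − k` — E8's `SI_k ⊔ xyRich(k, P, P∞)` is this intersection in that range (E8 itself needs only `k + P + P∞ + 1 ≤ n`). -/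
theorem Kr_w_node_zero_add_rev {k P Pinf : ℕ} {q₀ qinf : ℕ → K} (hq : ∀ j, P < j → q₀ j = 0) (hqP : q₀ P ≠ 0)
    (hqi : ∀ j, Pinf < j → qinf j = 0) (hqiP : qinf Pinf ≠ 0) (hDk : P + Pinf + 2 ≤ k + 1) (hDn : P + Pinf + 2 ≤ n + 1 - k) :
    Kr K Finset.univ (w K n n (fun j => q₀ j + rev K n qinf j)) k = (siegelIdeal K n k ⊔ xRich K n k P) ⊓ (siegelIdeal K n k ⊔ yRich K n k Pinf) := by
  have hlam : Function.Injective (fun _ : Fin 1 => (0 : K)) := fun a b _ => Subsingleton.elim a b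
  have e : (fun j => q₀ j + rev K n qinf j) = fun j => (∑ i : Fin 1, expMul K ((fun _ : Fin 1 => (0 : K)) i) ((fun _ : Fin 1 => q₀) i) j) + rev K n qinf j := by
    funext j; simp [expMul_zero_left]
  have hsum : ∑ i : Fin 1, ((fun _ : Fin 1 => P) i + 1) = P + 1 := by simp
  have hkP : k + P ≤ n := by omega
  rw [e, Kr_w_expMul_sum_add_rev K hlam (P := fun _ : Fin 1 => P) (fun i j hj => hq j hj) (fun i => hqP) hqi hqiP
      (by rw [hsum]; omega) (by rw [hsum]; omega), iInf_unique]
  show (siegelIdeal K n k ⊔ (xRich K n k P).map (Φs K (n := n) 0).toLinearMap) ⊓ _ = _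
  rw [← Kr_w_expMul_of_order K (0 : K) hkP hq hqP, show expMul K 0 q₀ = q₀ from funext (expMul_zero_left K q₀), Kr_w_eq_of_order K hkP hq hqP]

end Summit.Ventures.HSemireg.Wedge.HankelFrameChange
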